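import Summits.SmoothPoincare4.SmoothPoincare4.Theorems.SullivanDualTargetOfSympcap
import Summits.SmoothPoincare4.SmoothPoincare4.Theorems.SullivanDualWitnessChargeHelperEndHolomorphic
import Literature.Geometry.Symplectic.JHolomorphicOn
import Literature.Geometry.Symplectic.GromovR4StdModel
import Summits.SmoothPoincare4.SmoothPoincare4.Theorems.SullivanDualTargetLtcMaxPrinciple
import Summits.SmoothPoincare4.SmoothPoincare4.Theorems.SullivanDualTargetLtcEndHolomorphic

/-!
# SmoothPoincare4 / SullivanDual — crux `Target` (stmt-SmoothPoincare4-7823), line `last-twisted-circle`: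
# `stub_endConfinement` — the maximum principle at the standard end (assembly, lead c6)

We prove the registered stub `stub_endConfinement` of the skeleton
`Cruxes/Target/Lines/last_twisted_circle.lean` — the MAXIMUM PRINCIPLE AT THE STANDARD END: let `J`
be standard on the punctured `ε`-chart-ball of `Σ ∖ p` (closed ball inside the chart target) and
`u : ℂ → Σ ∖ p` be `C^∞` and `J`-holomorphic on `ℂ ∖ 0`, off the `ε`-ball for `0 < ‖z‖ < r₁` and
for `‖z‖ > R₂`; then `u` is off the `ε`-ball on all of `ℂ ∖ 0`.

Proof.  `Ω := {z ≠ 0 | u z ∈ B_ε}` is open and lies in the annulus `r₁ ≤ ‖z‖ ≤ R₂`; by continuity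
`u(closure Ω)` lies in the compact closed chart region `{x | ‖e x − e p‖ ≤ ε}`, so the flat complex
coordinates `Y = Ycoord p ∘ u` are continuous on `closure Ω` and HOLOMORPHIC on `Ω`
(`helper_ltcEndHolomorphic`, p135834: standardness of `J` makes `d(Y ∘ u)` complex linear), with
Euclidean norm `‖realify (Y z)‖ = ‖e(u z) − e p‖⁻¹ > ε⁻¹` inside and `= ε⁻¹` on the frontier; the
maximum principle for the Euclidean norm of a holomorphic map into `ℂ²` on a bounded open set
(`helper_ltcMaxPrinciple`, p135777, from Mathlib's `Complex.norm_le_of_forall_mem_frontier_norm_le`)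
forces `Ω = ∅`.

References: standard (maximum modulus principle); for the role of the statement cf. C. Gerig,
*Taming the pseudoholomorphic beasts in ℝ × (S¹ × S²)*, Geom. Topol. 24 (2020), and the line card
`Cruxes/Target/Lines/last-twisted-circle.md`.
-/

noncomputable section

set_option linter.dupNamespace false

open scoped Manifold ContDiff Topology
open Set Filter MeasureTheory Literature.Geometry.Kaehler Literature.Geometry.Symplectic
  Literature.Topology.FourManifolds
open Summit.SmoothPoincare4.SmoothPoincare4.Theorems.WitnessCharge.PencilIncompleteness

namespace Summit.SmoothPoincare4.SmoothPoincare4.Theorems.Target.LastTwistedCircle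

local notation "E4" => EuclideanSpace ℝ (Fin 4)

/-! ## The registered stub -/

/-- **Stub 5 of line `last-twisted-circle` — `EndConfinement`: the maximum principle at the
standard end.**  Let `J` be standard on the punctured `ε`-chart-ball of `Σ ∖ p` (closed ball
inside the chart target) and `u : ℂ → Σ ∖ p` be `C^∞` and `J`-holomorphic on `ℂ ∖ 0`, off the
`ε`-ball for `0 < ‖z‖ < r₁` and for `‖z‖ > R₂`.  Then `u` is off the `ε`-ball on all of `ℂ ∖ 0`.
Proof: `Ω := {z ≠ 0 | u z ∈ B_ε}` is open and lies in the annulus `r₁ ≤ ‖z‖ ≤ R₂`; by continuity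
`u(closure Ω)` lies in the compact closed chart region `{‖e x − e p‖ ≤ ε}`, so the flat complex
coordinates `Y = Ycoord p ∘ u` are continuous on `closure Ω`, HOLOMORPHIC on `Ω`
(`helper_ltcEndHolomorphic`: standardness of `J`), of Euclidean norm `‖e(u z) − e p‖⁻¹ > ε⁻¹`
inside and `= ε⁻¹` on the frontier; the maximum principle (`helper_ltcMaxPrinciple`) forces
`Ω = ∅`. [folklore] -/
theorem stub_endConfinement :
    ∀ (S : HomotopySphere 4) (p : S.carrier) (ε : ℝ) (J : ∀ x : punctured p, TangentSpace (𝓡 4) x →L[ℝ] TangentSpace (𝓡 4) x)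
      (u : ℂ → punctured p) (r₁ R₂ : ℝ),
      0 < ε → Metric.closedBall (extChartAt (𝓡 4) p p) ε ⊆ (extChartAt (𝓡 4) p).target →
      (∀ x : punctured p, InPuncturedChartBall p ε x → ∀ (v : TangentSpace (𝓡 4) x) (b : E4),
        inner ℝ (fderiv ℝ inversion (extChartAt (𝓡 4) p x.1 - extChartAt (𝓡 4) p p)
          (mfderiv (𝓡 4) 𝓘(ℝ, E4) (fun z : punctured p => extChartAt (𝓡 4) p z.1) x (J x v))) b =
        stdSymplecticForm (fderiv ℝ inversion (extChartAt (𝓡 4) p x.1 - extChartAt (𝓡 4) p p)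
          (mfderiv (𝓡 4) 𝓘(ℝ, E4) (fun z : punctured p => extChartAt (𝓡 4) p z.1) x v)) b) →
      (∀ z : ℂ, z ≠ 0 → ContMDiffAt 𝓘(ℝ, ℂ) (𝓡 4) ∞ u z) →
      IsJHolomorphicOn (𝓡 4) J u {z : ℂ | z ≠ 0} →
      0 < r₁ →
      (∀ z : ℂ, z ≠ 0 → ‖z‖ < r₁ → ¬ InPuncturedChartBall p ε (u z)) →
      (∀ z : ℂ, R₂ < ‖z‖ → ¬ InPuncturedChartBall p ε (u z)) →
      ∀ z : ℂ, z ≠ 0 → ¬ InPuncturedChartBall p ε (u z) := by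
  intro S p ε J u r₁ R₂ hε hball hstd hsm hhol hr₁ h0 hinf z hz hzin
  classical
  set e := extChartAt (𝓡 4) p with he
  set Ω : Set ℂ := {w | w ≠ 0 ∧ InPuncturedChartBall p ε (u w)} with hΩ
  have hzΩ : z ∈ Ω := ⟨hz, hzin⟩
  obtain ⟨hdiff, hcontY, hnormY⟩ := helper_ltcEndHolomorphic S p ε J u hε hball hstd hsm hhol
  -- `u` is continuous on `ℂ ∖ 0`
  have hA : IsOpen {w : ℂ | w ≠ 0} := isOpen_ne
  have hucont : ContinuousOn u {w : ℂ | w ≠ 0} := fun w hw =>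
    (hsm w hw).continuousAt.continuousWithinAt
  -- `Ω` is open
  have hΩopen : IsOpen Ω := by
    have h : IsOpen ({w : ℂ | w ≠ 0} ∩ u ⁻¹' {x : punctured p | InPuncturedChartBall p ε x}) :=
      hucont.isOpen_inter_preimage hA (isOpen_setOf_inPuncturedChartBall p ε)
    convert h using 1
    ext w
    simp only [hΩ, Set.mem_setOf_eq, Set.mem_inter_iff, Set.mem_preimage]
  -- `Ω` lies in the annulus `r₁ ≤ ‖w‖ ≤ R₂`
  have hΩann : Ω ⊆ {w : ℂ | r₁ ≤ ‖w‖ ∧ ‖w‖ ≤ R₂} := by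
    intro w hw
    refine ⟨?_, ?_⟩
    · by_contra h
      exact h0 w hw.1 (not_le.1 h) hw.2
    · by_contra h
      exact hinf w (not_le.1 h) hw.2
  have hΩR : Ω ⊆ Metric.closedBall (0 : ℂ) R₂ := fun w hw => by
    rw [Metric.mem_closedBall, dist_zero_right]
    exact (hΩann hw).2
  have hann_closed : IsClosed {w : ℂ | r₁ ≤ ‖w‖ ∧ ‖w‖ ≤ R₂} :=
    (isClosed_le continuous_const continuous_norm).inter (isClosed_le continuous_norm continuous_const)
  have hclΩ : closure Ω ⊆ {w : ℂ | r₁ ≤ ‖w‖ ∧ ‖w‖ ≤ R₂} := closure_minimal hΩann hann_closed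
  have hcl_ne : ∀ w ∈ closure Ω, w ≠ 0 := fun w hw h0' => by
    have := (hclΩ hw).1
    rw [h0', norm_zero] at this
    exact absurd this (not_le.2 hr₁)
  -- the closed chart region `K = {‖e x − e p‖ ≤ ε}` and `u(closure Ω) ⊆ K`
  set K : Set (punctured p) := {x | x.1 ∈ (chartAt E4 p).source ∧ ‖e x.1 - e p‖ ≤ ε} with hK
  have hKclosed : IsClosed K := by
    have hcpt : IsCompact (e.symm '' Metric.closedBall (e p) ε) :=
      (isCompact_closedBall (e p) ε).image_of_continuousOn
        ((continuousOn_extChartAt_symm (I := 𝓡 4) p).mono hball)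
    have hK' : K = Subtype.val ⁻¹' (e.symm '' Metric.closedBall (e p) ε) := by
      ext x
      simp only [hK, Set.mem_setOf_eq, Set.mem_preimage, Set.mem_image, Metric.mem_closedBall,
        dist_eq_norm]
      constructor
      · rintro ⟨hxs, hxn⟩
        exact ⟨e x.1, hxn, e.left_inv (by rw [he, extChartAt_source]; exact hxs)⟩
      · rintro ⟨y, hy, hyx⟩
        have hyt : y ∈ e.target := hball (by rwa [Metric.mem_closedBall, dist_eq_norm])
        have hsrc : e.symm y ∈ (chartAt E4 p).source := by
          rw [← extChartAt_source (I := 𝓡 4)]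
          exact e.map_target hyt
        rw [← hyx]
        exact ⟨hsrc, by rw [e.right_inv hyt]; exact hy⟩
    rw [hK']
    exact hcpt.isClosed.preimage continuous_subtype_val
  have hΩK : u '' Ω ⊆ K := by
    rintro x ⟨w, hw, rfl⟩
    have hb := hw.2
    exact ⟨hb.1, by
      have h2 := hb.2
      rw [Metric.mem_ball, dist_eq_norm] at h2
      exact h2.le⟩
  have hucl : ContinuousOn u (closure Ω) := hucont.mono fun w hw => hcl_ne w hw
  have huK : ∀ w ∈ closure Ω, u w ∈ K := fun w hw =>
    (closure_minimal hΩK hKclosed) (hucl.image_closure ⟨w, hw, rfl⟩)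
  -- `e x ≠ e p` on the punctured chart source
  have hne : ∀ x : punctured p, x.1 ∈ (chartAt E4 p).source → e x.1 - e p ≠ 0 := by
    intro x hx h0'
    have h1 : e x.1 = e p := sub_eq_zero.1 h0'
    have h2 : x.1 = p :=
      e.injOn (by rw [he, extChartAt_source]; exact hx) (mem_extChartAt_source (I := 𝓡 4) p) h1
    exact (mem_punctured.1 x.2) h2
  -- the flat coordinates along `u`
  set Y : ℂ → ℂ × ℂ := fun w => Ycoord p (u w) with hY
  have hYcont : ContinuousOn Y (closure Ω) := fun w hw =>
    (hcontY w (hcl_ne w hw) (huK w hw).1).continuousWithinAt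
  have hfront : ∀ w ∈ frontier Ω, ‖realify (Y w)‖ ≤ ε⁻¹ := by
    intro w hw
    rw [hΩopen.frontier_eq, Set.mem_sdiff] at hw
    obtain ⟨hwcl, hwΩ⟩ := hw
    have hwK := huK w hwcl
    have hw0 := hcl_ne w hwcl
    have hnot : ¬ InPuncturedChartBall p ε (u w) := fun hb => hwΩ ⟨hw0, hb⟩
    have hge : ε ≤ ‖e (u w).1 - e p‖ := by
      by_contra h
      exact hnot ⟨hwK.1, by rw [Metric.mem_ball, dist_eq_norm]; exact not_le.1 h⟩
    have heq : ‖e (u w).1 - e p‖ = ε := le_antisymm hwK.2 hge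
    show ‖realify (Ycoord p (u w))‖ ≤ ε⁻¹
    rw [hnormY (u w) hwK.1, heq]
  have hinner : ∀ w ∈ Ω, ε⁻¹ < ‖realify (Y w)‖ := by
    intro w hw
    have hb := hw.2
    show ε⁻¹ < ‖realify (Ycoord p (u w))‖
    rw [hnormY (u w) hb.1]
    have hlt : ‖e (u w).1 - e p‖ < ε := by
      have h2 := hb.2
      rwa [Metric.mem_ball, dist_eq_norm] at h2
    exact (inv_lt_inv₀ hε (norm_pos_iff.2 (hne (u w) hb.1))).2 hlt
  have hempty : Ω = ∅ :=
    helper_ltcMaxPrinciple Ω Y ε⁻¹ R₂ hΩopen hΩR hdiff hYcont hfront hinner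
  rw [hempty] at hzΩ
  exact hzΩ

end Summit.SmoothPoincare4.SmoothPoincare4.Theorems.Target.LastTwistedCircle

end
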